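/- Copyright: the b2b-balaban cell (near-miss cell 7), T⁴-continuum fan-out, lineage t4-ne7b-p1 (node U5c COUNT
member).  Released under the licence of the surrounding project. -/
import Summits.QuantumFields.BalabanUV.T4Continuum.Support.HistoryGenealogyPedigreeHead
import Summits.QuantumFields.BalabanUV.T4Continuum.Support.HistoryGenealogyPedigreeTiming
import Summits.QuantumFields.BalabanUV.T4Continuum.Support.HistoryGenealogyChainJoin
import Summits.QuantumFields.BalabanUV.T4Continuum.Support.HistoryRealiseWeak

/-!
# THE PEDIGREE OF A COMPONENT HISTORY, part 4a (junction M4, brick 2c — chains): left-nested join chains realised in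
the memory-agnostic currency, the list plumbing, and the last step of a component's `PGen` (owner module of row NE7b,
lineage `t4-ne7b-p1` gen 41; re-open object (α), `SCOPE-alpha.md` v2.3 §5 row M4; repair route R-41-a — PRE-POSITIONING
ONLY)

Summits-side support leaf of the T⁴-continuum cell (rung (B)+1 on a FINITE torus only; NOT infinite volume, NOT the
mass gap, NOT the Clay statement; NOT a proof of the spine estimate NE7b, which is the cell's OWN estimate, NOT PRINTED
and NOT PROVED).  [folklore] finite combinatorics in the ℤᵈ index model over parts 1–3 (`pedOf`, `OrderOK`, the
`toPGen` unfoldings), brick 1 (`TouchPrefix`, `img`, `unionL`) and the memory-agnostic core `HistoryRealiseWeak`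
(`RealisesW`); nothing printed is asserted, no `def … : Prop` fact of Bałaban's, zero `sorry`.

WHAT IS PROVED.  §1 **`realisesW_chainJoin`** (brick 1's `realisesP_chainJoin` with `RealisesP ↦ RealisesW` — the join
clause is the same: head realised, further parts realised with `lastStep ≤ sj` and pending before `sj`, images in
`TouchPrefix` order, domain inside the union ⟹ the left-nested chain is realised), `unionL_subset_of_forall_mem`,
**`realisesW_chainJoin_cons₂`** (the list plumbing, once: constituent pairs `P x`, image function `f`).  §2
`constit_eq_singleton_of_ord`, `two_le_length_constit_of_ord`, **`lastStep_toPGen_eq_pgenR`** (the last step of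
`toPGen cell (j, c)` IS print's extraction's `(pgenR rnw j c).lastStep`, any admissible order).

HONEST.  Proves nothing of Bałaban's; NE7b NOT proved; spine 0∕9.  HONEST DEPENDENCY (cell): continuum YM on T⁴ ⇐
BetaPertH ∧ nine spine estimates (0/9 proved); BetaPertH ⇐ (D1) ∧ (D4) ∧ CAP+tail; G-an2-4 gates asym, D1 and NE2/3/4.
This file changes none of it. -/

open Finset
open Literature.MathematicalPhysics.QuantumFieldTheory.Balaban1983to89
open Literature.MathematicalPhysics.QuantumFieldTheory.Balaban1983to89.B13ScaleTransfer
open Literature.MathematicalPhysics.QuantumFieldTheory.Balaban1983to89.B16SProfile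
open Literature.MathematicalPhysics.QuantumFieldTheory.Balaban1983to89.B16MergeGeometry
open T4PersistenceDictionary
open Summit.QuantumFields.BalabanUV.T4Continuum.HistoryAdmissible
open Summit.QuantumFields.BalabanUV.T4Continuum.HistoryRealise
open Summit.QuantumFields.BalabanUV.T4Continuum.HistoryRealisePrint
open Summit.QuantumFields.BalabanUV.T4Continuum.HistoryRealiseWeak
open Summit.QuantumFields.BalabanUV.T4Continuum.HistoryGen
open Summit.QuantumFields.BalabanUV.T4Continuum.HistoryGenealogyExtraction
open Summit.QuantumFields.BalabanUV.T4Continuum.HistoryGenealogyRealise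

namespace Summit.QuantumFields.BalabanUV.T4Continuum.HistoryGenealogyPedigree

noncomputable section

variable {d : ℕ}

/-! ## §1 Left-nested join chains realised, memory-agnostic form -/

section ChainJoin

variable {L : ℕ} {s R : ℕ → ℕ}

/-- **LEFT-NESTED JOIN CHAINS REALISED (W currency)**: head `A` realised by `ZA`, further parts `Bs` each realised by its
listed domain, all with `lastStep ≤ sj` and pending STRICTLY BEFORE `sj`, images in `TouchPrefix` order from the head's
image, `Z` inside the union of all images ⟹ `RealisesW (chainJoin A (Bs.map Prod.fst) sj) Z` (nonempty `Bs`).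
Brick 1's proof with `RealisesP ↦ RealisesW` (the join clause is the same). [folklore] -/
theorem realisesW_chainJoin (sj : ℕ) :
    ∀ (A : PGen (Lab d)) (ZA : Finset (Pt d)) (Bs : List (PGen (Lab d) × Finset (Pt d))), Bs ≠ [] →
      RealisesW L s R A ZA → A.lastStep ≤ sj → PendingBefore L s R A.lastStep ZA sj →
      (∀ BZ ∈ Bs, RealisesW L s R BZ.1 BZ.2 ∧ BZ.1.lastStep ≤ sj ∧ PendingBefore L s R BZ.1.lastStep BZ.2 sj) →
      TouchPrefix (img L s sj (A, ZA)) (Bs.map (img L s sj)) →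
      ∀ Z, Z ⊆ img L s sj (A, ZA) ∪ unionL (Bs.map (img L s sj)) →
        RealisesW L s R (chainJoin A (Bs.map Prod.fst) sj) Z
  | _, _, [], hne, _, _, _, _, _, _, _ => (hne rfl).elim
  | A, ZA, [BZ], _, hA, hAs, hAp, hall, hct, Z, hZ => by
      obtain ⟨hB, hBs, hBp⟩ := hall BZ (by simp)
      have hct' : (∃ a ∈ img L s sj (A, ZA), ∃ c ∈ img L s sj BZ, Touch a c) := by
        simpa [TouchPrefix] using hct
      obtain ⟨a, ha, c, hc, hac⟩ := hct'
      have hZ' : Z ⊆ img L s sj (A, ZA) ∪ img L s sj BZ := by simpa using hZ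
      show RealisesW L s R (PGen.join A BZ.1 sj) Z
      exact ⟨ZA, BZ.2, hA, hB, hAs, hBs, hAp, hBp, ⟨a, ha, c, hc, hac⟩, hZ'⟩
  | A, ZA, BZ :: CZ :: Bs, _, hA, hAs, hAp, hall, hct, Z, hZ => by
      obtain ⟨hB, hBs, hBp⟩ := hall BZ (by simp)
      rw [List.map_cons, touchPrefix_cons] at hct
      obtain ⟨⟨a, ha, c, hc, hac⟩, hrest⟩ := hct
      set A' : PGen (Lab d) := PGen.join A BZ.1 sj with hA'
      set ZA' : Finset (Pt d) := img L s sj (A, ZA) ∪ img L s sj BZ with hZA'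
      have hreal' : RealisesW L s R A' ZA' :=
        ⟨ZA, BZ.2, hA, hB, hAs, hBs, hAp, hBp, ⟨a, ha, c, hc, hac⟩, subset_rfl⟩
      have hlast' : A'.lastStep = sj := rfl
      have himg' : img L s sj (A', ZA') = ZA' := by simp [img, hlast']
      show RealisesW L s R (chainJoin (PGen.join A BZ.1 sj) ((CZ :: Bs).map Prod.fst) sj) Z
      refine realisesW_chainJoin sj A' ZA' (CZ :: Bs) (by simp) hreal' hlast'.le
        (by rw [hlast']; exact ⟨le_rfl, fun k hk _ => by omega⟩)
        (fun W hW => hall W (by simp only [List.mem_cons] at hW ⊢; exact Or.inr hW)) ?_ Z ?_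
      · rw [himg']; exact hrest
      · rw [himg']
        intro x hx
        have hx' := hZ hx
        simp only [List.map_cons, unionL_cons, Finset.mem_union, hZA'] at hx' ⊢
        tauto

/-- the union of a list of domains depends only on its members [folklore] -/
theorem unionL_subset_of_forall_mem {L₁ L₂ : List (Finset (Pt d))} (h : ∀ A ∈ L₁, A ∈ L₂) : unionL L₁ ⊆ unionL L₂ := by
  intro x hx
  obtain ⟨A, hA, hxA⟩ := mem_unionL.1 hx
  exact mem_unionL.2 ⟨A, h A hA, hxA⟩

/-- **THE LIST PLUMBING, ONCE**: a list `q₀ :: q₁ :: qs` of constituents with pairs `P x = (history, domain)` each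
realised with `lastStep ≤ sj` and pending before `sj`, whose images at `sj` are `f x`, in prefix-touch order for `f`,
and a domain `Z` inside the union of the `f x` ⟹ the left-nested chain of the histories at `sj` is realised by `Z`
and has last step `sj`. [folklore] -/
theorem realisesW_chainJoin_cons₂ (sj : ℕ) (P : Lab d ⊕ Lab d → PGen (Lab d) × Finset (Pt d))
    (f : Lab d ⊕ Lab d → Finset (Pt d)) (q₀ q₁ : Lab d ⊕ Lab d) (qs : List (Lab d ⊕ Lab d))
    (hall : ∀ x ∈ q₀ :: q₁ :: qs,
      RealisesW L s R (P x).1 (P x).2 ∧ (P x).1.lastStep ≤ sj ∧ PendingBefore L s R (P x).1.lastStep (P x).2 sj)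
    (himg : ∀ x ∈ q₀ :: q₁ :: qs, img L s sj (P x) = f x) (hct : TouchPrefix (f q₀) ((q₁ :: qs).map f))
    {Z : Finset (Pt d)} (hZ : Z ⊆ unionL ((q₀ :: q₁ :: qs).map f)) :
    RealisesW L s R (chainJoin (P q₀).1 ((q₁ :: qs).map fun x => (P x).1) sj) Z ∧
      (chainJoin (P q₀).1 ((q₁ :: qs).map fun x => (P x).1) sj).lastStep = sj := by
  have hmapimg : ((q₁ :: qs).map P).map (img L s sj) = (q₁ :: qs).map f := by
    rw [List.map_map]
    exact List.map_congr_left fun x hx => himg x (List.mem_cons_of_mem _ hx)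
  have hfst : (q₁ :: qs).map (fun x => (P x).1) = ((q₁ :: qs).map P).map Prod.fst := by
    rw [List.map_map]; rfl
  obtain ⟨hA, hAs, hAp⟩ := hall q₀ List.mem_cons_self
  refine ⟨?_, ?_⟩
  · rw [hfst]
    refine realisesW_chainJoin sj (P q₀).1 (P q₀).2 ((q₁ :: qs).map P) (by simp) hA hAs hAp
      (fun W hW => ?_) ?_ Z ?_
    · obtain ⟨x, hx, rfl⟩ := List.mem_map.1 hW
      exact hall x (List.mem_cons_of_mem _ hx)
    · rw [hmapimg, show ((P q₀).1, (P q₀).2) = P q₀ from rfl, himg q₀ List.mem_cons_self]; exact hct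
    · rw [hmapimg, show ((P q₀).1, (P q₀).2) = P q₀ from rfl, himg q₀ List.mem_cons_self]
      simpa using hZ
  · rw [List.map_cons]; exact lastStep_chainJoin_cons _ _ _ sj

end ChainJoin

/-! ## §2 The last step of a component's `PGen` is print's extraction's -/

section LastStep

variable {H : ComponentHistory (Lab d)} {rnw : ℕ → Lab d → Bool} {ord : ℕ → Lab d → List (Lab d ⊕ Lab d)}

/-- a permutation of a singleton is that singleton: a lone constituent in the chosen order is lone in print's list
[folklore] -/
theorem constit_eq_singleton_of_ord (hO : OrderOK H ord) {j : ℕ} {c : Lab d} (hc : c ∈ H.comp j) {q : Lab d ⊕ Lab d}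
    (h : ord j c = [q]) : H.constit j c = [q] := by
  have hp := hO j c hc
  rw [h] at hp
  exact (List.singleton_perm.1 hp).symm

/-- at least two constituents in the chosen order are at least two in print's list [folklore] -/
theorem two_le_length_constit_of_ord (hO : OrderOK H ord) {j : ℕ} {c : Lab d} (hc : c ∈ H.comp j)
    {q₀ q₁ : Lab d ⊕ Lab d} {qs : List (Lab d ⊕ Lab d)} (h : ord j c = q₀ :: q₁ :: qs) :
    2 ≤ (H.constit j c).length := by
  rw [← (hO j c hc).length_eq, h]; simp

/-- **THE LAST STEP OF `toPGen cell (j, c)` IS THE LAST STEP OF `pgenR rnw j c`** (any admissible order): inherited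
through a lone unflagged part, the level otherwise — on both sides. [folklore] -/
theorem lastStep_toPGen_eq_pgenR {δ : Type*} [Inhabited δ] (cell : Lab d → δ) (hW : H.WF) (hO : OrderOK H ord) :
    ∀ (j : ℕ) (c : Lab d), c ∈ H.comp j →
      ((pedOf H rnw ord).toPGen cell (j, c)).lastStep = (H.pgenR rnw j c).lastStep := by
  intro j
  induction j with
  | zero =>
      intro c hc
      have h1 := lastStep_toPGen_le cell hW hO (rnw := rnw) hc
      have h2 := H.lastStep_pgenR_le rnw 0 c
      omega
  | succ j ih =>
      intro c hc
      obtain ⟨q₀, qs, hqs⟩ := List.exists_cons_of_ne_nil (ord_ne_nil hW hO hc)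
      cases qs with
      | cons q₁ qs' =>
          -- ≥ 2 constituents: both last steps are the level
          rw [toPGen_succ_chain H rnw ord cell hc hqs, List.map_cons, lastStep_chainJoin_cons, ComponentHistory.pgenR_succ_eq]
          have h2 := two_le_length_constit_of_ord hO hc hqs
          obtain ⟨x, l, hxl⟩ := List.exists_cons_of_ne_nil (hW.nonempty (j + 1) c hc)
          obtain ⟨y, l', hyl⟩ : ∃ y l', l = y :: l' := by
            cases l with
            | nil => rw [hxl] at h2; simp at h2
            | cons y l' => exact ⟨y, l', rfl⟩
          subst hyl
          simp only [ComponentHistory.constituentsR, hxl, List.map_cons, assembleR_cons_cons, lastStep_joinTail_cons]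
      | nil =>
          have hcs := constit_eq_singleton_of_ord hO hc hqs
          cases q₀ with
          | inr n => rw [toPGen_succ_birth H rnw ord cell hc hqs, H.pgenR_succ_birth rnw j c n hcs]; rfl
          | inl p =>
              have hp : p ∈ H.comp j := hW.parts_sub j c hc p (by simp [ComponentHistory.parts, hcs])
              cases hr : rnw j p with
              | false =>
                  rw [toPGen_succ_lone H rnw ord cell hc hqs hr, H.pgenR_succ_lone rnw j c p hcs hr]
                  exact ih p hp
              | true =>
                  rw [toPGen_succ_renew H rnw ord cell hc hqs hr, H.pgenR_succ_renew rnw j c p hcs hr]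
                  rfl

end LastStep

end

end Summit.QuantumFields.BalabanUV.T4Continuum.HistoryGenealogyPedigree
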